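import Literature.Claims.NS.ClayR3BKMBridge
import Literature.Analysis.FluidPDE.ClassicalNSGlobalOfEnstrophyBound
import HarnessLib

/-!
# Clay (A)/(C) reference — the ENSTROPHY / `H¹` forms: (A) ⇔ an a priori bound on the enstrophy
# `∫|curl u(t)|²` (equivalently on `‖∇u(t)‖²_{L²}`, or on any `L²` Sobolev seminorm) of finite-energy
# classical solutions on half-open slabs; an enstrophy blow-up certificate proves (C)

Companion to `ClayR3BlowupAlternative.lean` ((A) ⇔ a priori `L^∞` bound), `ClayR3BKMBridge.lean`
((A) ⇔ a priori vorticity-sup / BKM-integral bound) and `ClayR3SupBlowupCertificate.lean` (sup-norm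
certificates ⇒ (C)). The decisive printed sentence of most «a priori estimate ⇒ global regularity»
manuscripts on `ℝ³` is an ENSTROPHY (or `H¹`) bound, «`‖∇u(t)‖_{L²}` (or `‖ω(t)‖_{L²}`) stays bounded
for smooth finite-energy solutions». This file records, in the Clay vocabulary of `ClayVariants.lean`
and over theorems of the tree only, that such a bound — for every finite-energy classical solution of
the unforced system on a half-open slab `[0, T) × ℝ³` from a smooth divergence-free datum of class
(4) — IS Fefferman's (A), and that its failure along one such solution IS a (C)-certificate:

* `exists_sobolevBound_of_clayR3_solvable` — Clay solvability of `(μ, 0, u₀)` bounds every `L²`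
  Sobolev seminorm `∫ ‖Dⁿu(t)‖²` of every finite-energy classical solution from `u₀` on its half-open
  horizon `[0, T)` (the `L²` twin of `exists_bounds_of_clayR3_solvable`: Tao's uniqueness Cor. 11.4
  `eqOn_Ico_of_claySolution` + persistence of regularity Cor. 11.1);
  `exists_enstrophy_le_of_clayR3_solvable`, `exists_gradientL2_le_of_clayR3_solvable` — hence the
  enstrophy `∫ |curl u(t)|²` and `∫ ‖∇u(t)‖²` are bounded on `[0, T)`;
* `not_clayR3_solvable_of_enstrophyBlowupCertificate` / `…_of_sobolevBlowupCertificate` and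
  `navierStokesBreakdownR3_of_enstrophyBlowupCertificate` — an enstrophy (or `Hⁿ`-seminorm) blow-up
  along a finite-energy classical solution from a class-(4) datum excludes solvability, so proves (C);
* `not_clayR3_solvable_iff_exists_enstrophyBlowup` — solvability of `(μ, 0, u₀)` FAILS ⇔ some
  finite-energy classical solution from `u₀` on a half-open slab has unbounded enstrophy (Leray's
  alternative `clayR3_solvable_or_supBlowup` + the tree's `H¹` continuation principle
  `hasSobolevExtensionPast_of_uniform_H1_bound` + the whole-space `div`–`curl` estimate
  `lintegral_frobeniusNormSq_fderiv_le_lintegral_sq_norm_curl`, exactly as in the tree's enstrophy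
  door `exists_global_classical_of_apriori_enstrophy_bound`);
* `clayR3_regularityAt_iff_aprioriEnstrophyBound` / `clayR3_regularity_iff_aprioriEnstrophyBound(_at)`
  — **(A) ⇔ «every finite-energy classical solution of the unforced system on a half-open slab
  `[0, T) × ℝ³` from a smooth divergence-free class-(4) datum has BOUNDED ENSTROPHY on `[0, T)`»**
  (one viscosity ⇔ all viscosities, `clayR3_regularityAt_iff`);
* `clayR3_regularityAt_iff_aprioriGradientL2Bound` / `clayR3_regularity_iff_aprioriGradientL2Bound(_at)`
  — the same with `∫ ‖∇u(t)‖ₑ²` (lower integral of the operator norm of `fderiv`);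
* `exists_enstrophyBlowup_of_not_clayR3_regularity` — if (A) fails, it fails through an enstrophy
  blow-up of a finite-energy classical solution from a class-(4) datum.

Usage on a CARD (§3): a REG row whose decisive printed sentence is an a priori ENSTROPHY / `H¹` /
`Hⁿ` bound for smooth finite-energy solutions of the unforced problem from class-(4) data IS (A) —
cite `clayR3_regularity_iff_aprioriEnstrophyBound` / `…GradientL2Bound`; the deltas that remain are the
CLASS over which the bound is printed (Δ4/Δ5: periodic, mild-only, no energy hypothesis, slice-wise
rapid decay), `ν = 0` (Δ2) and forcing (Δ3), as listed in `ClayVariants.lean`.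

## References

* C. L. Fefferman, *Existence and smoothness of the Navier–Stokes equation*, CMI 2006, (A), (C) with
  (4)–(7) p. 2. [FeffermanClay2006]
* J. Leray, Acta Math. 63 (1934), §33 (the alternative), §20 (`‖∇u‖` controls regularity). [Leray1934]
* J. C. Robinson, J. L. Rodrigo, W. Sadowski, *The Three-Dimensional Navier–Stokes Equations*, CUP
  2016, Lemma 6.11 with Thm 6.15 (whole space: `‖∇u(t)‖² ≥ c'(T* − t)^{-1/2}` at a blow-up time, so a
  bounded `‖∇u‖` rules out blow-up), Thm 6.8. [RobinsonRodrigoSadowskiCUP2016]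
* P. Constantin, C. Fefferman, Indiana Univ. Math. J. 42 (1993), 775–789, §2 (end of proof: the
  enstrophy bound implies regularity). [ConstantinFeffermanIndiana1993]
* T. Tao, Anal. PDE 6 (2013) = arXiv:1108.1165, Thm 5.4, Cor. 11.1, Cor. 11.4. [Tao2011]

WHAT THIS IS NOT: not a claim about NS regularity or blow-up; not a claim about any author beyond
the typed locator.
-/

open scoped ContDiff ENNReal NNReal Topology

namespace Literature.Claims.NS.ClayVariants

open Set Filter MeasureTheory Function Literature.Analysis Literature.Analysis.FluidPDE

noncomputable section

variable {μ T : ℝ} {u₀ : EuclideanSpace ℝ (Fin 3) → EuclideanSpace ℝ (Fin 3)}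
  {u : ℝ → EuclideanSpace ℝ (Fin 3) → EuclideanSpace ℝ (Fin 3)} {p : ℝ → EuclideanSpace ℝ (Fin 3) → ℝ}

/-! ## Clay solvability bounds every `L²` Sobolev seminorm of a finite-energy classical solution -/

/-- **Clay (A)-solvability bounds every `L²` Sobolev seminorm of every finite-energy classical
solution from the same datum on its horizon.** Let `μ > 0`, `u₀` a `C¹` datum of class (4), and
`(u, p)` a classical solution of the unforced system on `[0, T) × ℝ³` with `u 0 = u₀` and finite energy
on `[0, T)`. If `(μ, 0, u₀)` is Clay-solvable, then for every `n` one constant bounds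
`∫ ‖Dⁿu(t)‖²` on `[0, T)`: the Clay solution equals `u` on `[0, T)` (Tao's Cor. 11.4,
`eqOn_Ico_of_claySolution`) and lies in Tao's class `L^∞_t H^k_x` on `[0, T]` (Cor. 11.1,
`IsClassicalNSSolutionOn.hasBoundedSobolevNormsOn_of_sobolevDatum_unforced`).
[cite: FeffermanClay2006, (A) with (4) (6) (7) p. 2] [cite: Tao2011, Cor. 11.4 + Cor. 11.1 (arXiv Cor. 71, Cor. 68)] -/
theorem exists_sobolevBound_of_clayR3_solvable (hμ : 0 < μ) (hu₀ : ContDiff ℝ 1 u₀)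
    (hdec : HasRapidSpatialDecay u₀)
    (hcl : IsClassicalNSSolutionOn (Ico 0 T) μ 0 u p) (hu0 : u 0 = u₀)
    (hE : ∃ A : ℝ≥0∞, A < ⊤ ∧ ∀ t ∈ Ico 0 T, ∫⁻ x, ‖u t x‖ₑ ^ 2 ≤ A)
    (hsol : clayR3.Solvable μ 0 u₀) (n : ℕ) :
    ∃ C : ℝ≥0, ∀ t ∈ Ico 0 T, ∫⁻ x, ‖iteratedFDeriv ℝ n (u t) x‖ₑ ^ 2 ≤ C := by
  rcases le_or_gt T 0 with hT | hT
  · exact ⟨0, fun t ht => absurd (ht.1.trans_lt (ht.2.trans_le hT)) (lt_irrefl 0)⟩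
  obtain ⟨w, q, hw, hw0, hwE⟩ := clayR3_solvable_zero_iff_classical.mp hsol
  have heq : ∀ t ∈ Ico 0 T, w t = u t :=
    eqOn_Ico_of_claySolution hμ (memLp_fderiv_two_of_rapidDecay hdec hu₀) hw hw0 hwE hcl hu0 hE
  have hw' : IsClassicalNSSolutionOn (Icc 0 T) μ 0 w q :=
    hw.mono Icc_subset_Ici_self (uniqueDiffOn_Icc hT)
  have hwE' : ∃ C : ℝ≥0, ∀ t ∈ Icc 0 T, ∫⁻ x, ‖w t x‖ₑ ^ 2 ≤ C := by
    obtain ⟨C, hC, hb⟩ := hwE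
    exact ⟨C.toNNReal, fun t ht => (hb t ht.1).trans (ENNReal.coe_toNNReal hC.ne).ge⟩
  have h₀ : ∀ m : ℕ, ∫⁻ x, ‖iteratedFDeriv ℝ m (w 0) x‖ₑ ^ 2 < ⊤ := fun m => by
    rw [hw0]; exact sobolevDatum_of_rapidDecay hdec m
  obtain ⟨C, hC⟩ := hw'.hasBoundedSobolevNormsOn_of_sobolevDatum_unforced hμ hT hwE' h₀ n
  exact ⟨C, fun t ht => by rw [← heq t ht]; exact hC t (Ico_subset_Icc_self ht)⟩

/-- **Clay solvability bounds the enstrophy**: under the hypotheses of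
`exists_sobolevBound_of_clayR3_solvable`, `∫ |curl u(t)|² ≤ M` on `[0, T)` (`|curl v| ≤ κ‖∇v‖`,
`κ = ‖curlCLM‖`, tree lemma `integrable_norm_curl_sq`).
[cite: FeffermanClay2006, (A) with (4) (6) (7) p. 2] [cite: Tao2011, Cor. 11.4 + Cor. 11.1] -/
theorem exists_enstrophy_le_of_clayR3_solvable (hμ : 0 < μ) (hu₀ : ContDiff ℝ 1 u₀)
    (hdec : HasRapidSpatialDecay u₀)
    (hcl : IsClassicalNSSolutionOn (Ico 0 T) μ 0 u p) (hu0 : u 0 = u₀)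
    (hE : ∃ A : ℝ≥0∞, A < ⊤ ∧ ∀ t ∈ Ico 0 T, ∫⁻ x, ‖u t x‖ₑ ^ 2 ≤ A)
    (hsol : clayR3.Solvable μ 0 u₀) :
    ∃ M : ℝ, ∀ t ∈ Ico 0 T, ∫ x, ‖curl (u t) x‖ ^ 2 ≤ M := by
  obtain ⟨C, hC⟩ := exists_sobolevBound_of_clayR3_solvable hμ hu₀ hdec hcl hu0 hE hsol 1
  refine ⟨‖curlCLM‖ ^ 2 * (C : ℝ), fun t ht => ?_⟩
  have hct2 : ContDiff ℝ 2 (u t) := (hcl.contDiff_velocity ht).of_le (by norm_cast)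
  have h1 : ∫⁻ x, ‖iteratedFDeriv ℝ 1 (u t) x‖ₑ ^ 2 < ⊤ := (hC t ht).trans_lt ENNReal.coe_lt_top
  exact (integrable_norm_curl_sq hct2 h1).2.trans
    (mul_le_mul_of_nonneg_left (ENNReal.toReal_le_coe_of_le_coe (hC t ht)) (sq_nonneg _))

/-- **Clay solvability bounds `‖∇u(t)‖²_{L²}`** (lower integral of the operator norm of `fderiv`) on
the half-open horizon of every finite-energy classical solution from the same class-(4) datum.
[cite: FeffermanClay2006, (A) with (4) (6) (7) p. 2] [cite: Tao2011, Cor. 11.4 + Cor. 11.1] -/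
theorem exists_gradientL2_le_of_clayR3_solvable (hμ : 0 < μ) (hu₀ : ContDiff ℝ 1 u₀)
    (hdec : HasRapidSpatialDecay u₀)
    (hcl : IsClassicalNSSolutionOn (Ico 0 T) μ 0 u p) (hu0 : u 0 = u₀)
    (hE : ∃ A : ℝ≥0∞, A < ⊤ ∧ ∀ t ∈ Ico 0 T, ∫⁻ x, ‖u t x‖ₑ ^ 2 ≤ A)
    (hsol : clayR3.Solvable μ 0 u₀) :
    ∃ C : ℝ≥0, ∀ t ∈ Ico 0 T, ∫⁻ x, ‖fderiv ℝ (u t) x‖ₑ ^ 2 ≤ C := by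
  obtain ⟨C, hC⟩ := exists_sobolevBound_of_clayR3_solvable hμ hu₀ hdec hcl hu0 hE hsol 1
  refine ⟨C, fun t ht => le_of_eq_of_le (lintegral_congr fun x => ?_) (hC t ht)⟩
  rw [← ofReal_norm, ← norm_iteratedFDeriv_one, ofReal_norm]

/-! ## Enstrophy / Sobolev blow-up certificates exclude solvability and prove (C) -/

/-- **An ENSTROPHY blow-up certificate excludes Clay solvability**: a finite-energy classical solution
on `[0, T) × ℝ³` from a `C¹` datum of class (4) whose enstrophy is UNBOUNDED on `[0, T)`
(`∀ M, ∃ t ∈ [0,T), M < ∫|curl u(t)|²`) ⇒ `(μ, 0, u₀)` has no Clay (A)-class solution.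
[cite: FeffermanClay2006, (A) (C) with (4)–(7) p. 2] [cite: Tao2011, Cor. 11.4 + Cor. 11.1] -/
theorem not_clayR3_solvable_of_enstrophyBlowupCertificate (hμ : 0 < μ) (hu₀ : ContDiff ℝ 1 u₀)
    (hdec : HasRapidSpatialDecay u₀)
    (hcl : IsClassicalNSSolutionOn (Ico 0 T) μ 0 u p) (hu0 : u 0 = u₀)
    (hE : ∃ A : ℝ≥0∞, A < ⊤ ∧ ∀ t ∈ Ico 0 T, ∫⁻ x, ‖u t x‖ₑ ^ 2 ≤ A)
    (hblow : ∀ M : ℝ, ∃ t ∈ Ico 0 T, M < ∫ x, ‖curl (u t) x‖ ^ 2) :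
    ¬ clayR3.Solvable μ 0 u₀ := fun hsol => by
  obtain ⟨M, hM⟩ := exists_enstrophy_le_of_clayR3_solvable hμ hu₀ hdec hcl hu0 hE hsol
  obtain ⟨t, ht, hMt⟩ := hblow M
  exact absurd hMt (not_lt.2 (hM t ht))

/-- **An `Hⁿ`-seminorm blow-up certificate excludes Clay solvability** (any `n`; `n = 1` is the `H¹`
form `‖∇u(t)‖_{L²} → ∞`): a finite-energy classical solution on `[0, T) × ℝ³` from a `C¹` class-(4)
datum with `∫ ‖Dⁿu(t)‖²` UNBOUNDED on `[0, T)` ⇒ `(μ, 0, u₀)` is not Clay-solvable.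
[cite: FeffermanClay2006, (A) (C) with (4)–(7) p. 2] [cite: Tao2011, Cor. 11.4 + Cor. 11.1] -/
theorem not_clayR3_solvable_of_sobolevBlowupCertificate (hμ : 0 < μ) (hu₀ : ContDiff ℝ 1 u₀)
    (hdec : HasRapidSpatialDecay u₀)
    (hcl : IsClassicalNSSolutionOn (Ico 0 T) μ 0 u p) (hu0 : u 0 = u₀)
    (hE : ∃ A : ℝ≥0∞, A < ⊤ ∧ ∀ t ∈ Ico 0 T, ∫⁻ x, ‖u t x‖ₑ ^ 2 ≤ A) (n : ℕ)
    (hblow : ∀ C : ℝ≥0, ∃ t ∈ Ico 0 T, (C : ℝ≥0∞) < ∫⁻ x, ‖iteratedFDeriv ℝ n (u t) x‖ₑ ^ 2) :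
    ¬ clayR3.Solvable μ 0 u₀ := fun hsol => by
  obtain ⟨C, hC⟩ := exists_sobolevBound_of_clayR3_solvable hμ hu₀ hdec hcl hu0 hE hsol n
  obtain ⟨t, ht, hCt⟩ := hblow C
  exact absurd hCt (not_lt.2 (hC t ht))

/-- **One enstrophy blow-up certificate at one viscosity `μ > 0` proves Clay (C)** (leaf
`NavierStokesBreakdownR3`, every viscosity, via `navierStokesBreakdownR3_of_not_solvable`); the datum
must be smooth, divergence free and of class (4), the solution classical with finite energy on
`[0, T)`. [cite: FeffermanClay2006, (C) p. 2] [cite: Tao2011, Cor. 11.4 + Cor. 11.1] -/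
theorem navierStokesBreakdownR3_of_enstrophyBlowupCertificate (hμ : 0 < μ) (hu₀ : ContDiff ℝ ∞ u₀)
    (hdiv : NSWave0.IsDivFree u₀) (hdec : HasRapidSpatialDecay u₀)
    (hcl : IsClassicalNSSolutionOn (Ico 0 T) μ 0 u p) (hu0 : u 0 = u₀)
    (hE : ∃ A : ℝ≥0∞, A < ⊤ ∧ ∀ t ∈ Ico 0 T, ∫⁻ x, ‖u t x‖ₑ ^ 2 ≤ A)
    (hblow : ∀ M : ℝ, ∃ t ∈ Ico 0 T, M < ∫ x, ‖curl (u t) x‖ ^ 2) :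
    Summit.NavierStokesRegularity.NavierStokesRegularity.NavierStokesBreakdownR3 :=
  navierStokesBreakdownR3_of_not_solvable hμ hu₀ hdiv hdec isSmoothOnHalfSpace_zero
    clayR3_force_zero
    (not_clayR3_solvable_of_enstrophyBlowupCertificate hμ (hu₀.of_le (by norm_cast)) hdec hcl hu0
      hE hblow)

/-- **One `Hⁿ`-seminorm blow-up certificate at one viscosity `μ > 0` proves Clay (C).**
[cite: FeffermanClay2006, (C) p. 2] [cite: Tao2011, Cor. 11.4 + Cor. 11.1] -/
theorem navierStokesBreakdownR3_of_sobolevBlowupCertificate (hμ : 0 < μ) (hu₀ : ContDiff ℝ ∞ u₀)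
    (hdiv : NSWave0.IsDivFree u₀) (hdec : HasRapidSpatialDecay u₀)
    (hcl : IsClassicalNSSolutionOn (Ico 0 T) μ 0 u p) (hu0 : u 0 = u₀)
    (hE : ∃ A : ℝ≥0∞, A < ⊤ ∧ ∀ t ∈ Ico 0 T, ∫⁻ x, ‖u t x‖ₑ ^ 2 ≤ A) (n : ℕ)
    (hblow : ∀ C : ℝ≥0, ∃ t ∈ Ico 0 T, (C : ℝ≥0∞) < ∫⁻ x, ‖iteratedFDeriv ℝ n (u t) x‖ₑ ^ 2) :
    Summit.NavierStokesRegularity.NavierStokesRegularity.NavierStokesBreakdownR3 :=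
  navierStokesBreakdownR3_of_not_solvable hμ hu₀ hdiv hdec isSmoothOnHalfSpace_zero
    clayR3_force_zero
    (not_clayR3_solvable_of_sobolevBlowupCertificate hμ (hu₀.of_le (by norm_cast)) hdec hcl hu0
      hE n hblow)

/-! ## An enstrophy bound along the maximal solution contradicts maximality -/

/-- In the class, `∫⁻ ‖curl v‖ₑ²` is the real enstrophy `∫ ‖curl v‖²` (`curl v` continuous and
square integrable for `v ∈ C²` with `Dv ∈ L²`). [folklore] -/
private theorem lintegral_enorm_curl_sq_eq_ofReal
    {v : EuclideanSpace ℝ (Fin 3) → EuclideanSpace ℝ (Fin 3)}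
    (hv : ContDiff ℝ 2 v) (h1 : ∫⁻ x, ‖iteratedFDeriv ℝ 1 v x‖ₑ ^ 2 < ⊤) :
    ∫⁻ x, ‖curl v x‖ₑ ^ 2 = ENNReal.ofReal (∫ x, ‖curl v x‖ ^ 2) := by
  have hint : Integrable (fun x => ‖curl v x‖ ^ 2) := (integrable_norm_curl_sq hv h1).1
  rw [ofReal_integral_eq_lintegral_ofReal hint (ae_of_all _ fun x => sq_nonneg _)]
  refine lintegral_congr fun x => ?_
  rw [← ofReal_norm, ENNReal.ofReal_pow (norm_nonneg _)]

/-- **The `H¹` continuation principle against Leray's maximality clause.** If `(u, p)` is a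
finite-energy classical solution on `[0, T*) × ℝ³`, `T* > 0`, from a class-(4) datum `u₀`, such that NO
finite-energy classical solution from `u₀` lives on a closed slab `[0, T]` with `T ≥ T*` (the
maximality clause of `clayR3_solvable_or_supBlowup`), then the enstrophy of `u` is not bounded on
`[0, T*)`: a bound `∫|curl u(t)|² ≤ M` gives, with the energy bound and the whole-space `div`–`curl`
estimate, a uniform `H¹` bound on `[0, T*)`, `u` lies in Tao's class on every `[0, T''] ⊂ [0, T*)`
(`hasBoundedSobolevNormsOn_Icc_of_finiteEnergy_Ico`), so `u` continues in the class past `T*`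
(`hasSobolevExtensionPast_of_uniform_H1_bound`) — a finite-energy classical solution on `[0, T*]`.
[cite: RobinsonRodrigoSadowskiCUP2016, Lemma 6.11 with Thm 6.15] [cite: ConstantinFeffermanIndiana1993, §2 (end of proof)] -/
private theorem false_of_enstrophyBound_of_maximal {Ts : ℝ} (hμ : 0 < μ) (hTs : 0 < Ts)
    (hdec : HasRapidSpatialDecay u₀)
    (hcl : IsClassicalNSSolutionOn (Ico 0 Ts) μ 0 u p) (hu0 : u 0 = u₀)
    (hE : ∃ A : ℝ≥0∞, A < ⊤ ∧ ∀ t ∈ Ico 0 Ts, ∫⁻ x, ‖u t x‖ₑ ^ 2 ≤ A)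
    (hmax : ∀ T : ℝ, Ts ≤ T →
      ∀ (w : ℝ → EuclideanSpace ℝ (Fin 3) → EuclideanSpace ℝ (Fin 3))
        (q : ℝ → EuclideanSpace ℝ (Fin 3) → ℝ),
        IsClassicalNSSolutionOn (Icc 0 T) μ 0 w q → w 0 = u₀ →
          ¬ ∃ A : ℝ≥0∞, A < ⊤ ∧ ∀ t ∈ Icc 0 T, ∫⁻ x, ‖w t x‖ₑ ^ 2 ≤ A)
    {M : ℝ} (hM : ∀ t ∈ Ico 0 Ts, ∫ x, ‖curl (u t) x‖ ^ 2 ≤ M) : False := by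
  have hreg : ∀ T'' < Ts, HasBoundedSobolevNormsOn (Icc 0 T'') u :=
    hasBoundedSobolevNormsOn_Icc_of_finiteEnergy_Ico hμ hdec hcl hu0 hE
  obtain ⟨A, hAtop, hA⟩ := hE
  have hM0 : 0 ≤ max M 0 := le_max_right _ _
  -- the uniform `H¹` bound on `[0, T*)`
  have hA1 : ∀ t ∈ Ico 0 Ts,
      (∫⁻ x, ‖u t x‖ₑ ^ 2) + (∫⁻ x, ENNReal.ofReal (frobeniusNormSq (fderiv ℝ (u t) x))) ≤
        ENNReal.ofReal (A.toReal + max M 0) := by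
    intro t ht
    have hct2 : ContDiff ℝ 2 (u t) := (hcl.contDiff_velocity ht).of_le (by norm_cast)
    have hL2 : ∫⁻ x, ‖u t x‖ₑ ^ 2 < ⊤ := (hA t ht).trans_lt hAtop
    -- `D¹u(t) ∈ L²`, read on the closed sub-slab `[0, (t + T*)/2]`
    have hT2 : (t + Ts) / 2 < Ts := by linarith [ht.2]
    obtain ⟨C₁, hC₁⟩ := hreg _ hT2 1
    have h1 : ∫⁻ x, ‖iteratedFDeriv ℝ 1 (u t) x‖ₑ ^ 2 < ⊤ :=
      (hC₁ t ⟨ht.1, by linarith [ht.2]⟩).trans_lt ENNReal.coe_lt_top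
    have hcurl : ∫⁻ x, ‖curl (u t) x‖ₑ ^ 2 ≤ ENNReal.ofReal (max M 0) := by
      rw [lintegral_enorm_curl_sq_eq_ofReal hct2 h1]
      exact ENNReal.ofReal_le_ofReal ((hM t ht).trans (le_max_left _ _))
    calc (∫⁻ x, ‖u t x‖ₑ ^ 2) + (∫⁻ x, ENNReal.ofReal (frobeniusNormSq (fderiv ℝ (u t) x)))
        ≤ A + ENNReal.ofReal (max M 0) := add_le_add (hA t ht)
          ((lintegral_frobeniusNormSq_fderiv_le_lintegral_sq_norm_curl hct2 (hcl.divFree t ht)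
            hL2).trans hcurl)
      _ = ENNReal.ofReal (A.toReal + max M 0) := by
          rw [ENNReal.ofReal_add ENNReal.toReal_nonneg hM0, ENNReal.ofReal_toReal hAtop.ne]
  -- continuation in the class past `T*`
  obtain ⟨T', hT'Ts, v, q, hv, hvB, hagree⟩ :=
    hasSobolevExtensionPast_of_uniform_H1_bound hμ hTs hcl hreg
      (add_nonneg ENNReal.toReal_nonneg hM0) hA1
  -- its restriction to `[0, T*]` is a finite-energy classical solution from `u₀`: forbidden
  have hv0 : v 0 = u₀ := by rw [hagree 0 ⟨le_rfl, hTs⟩, hu0]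
  obtain ⟨C₀, hC₀⟩ := hvB 0
  exact hmax Ts le_rfl v q (hv.mono (Icc_subset_Ico_right hT'Ts) (uniqueDiffOn_Icc hTs)) hv0
    ⟨C₀, ENNReal.coe_lt_top, fun t ht => by
      rw [lintegral_enorm_sq_eq_lintegral_iteratedFDeriv_zero]; exact hC₀ t ht⟩

/-! ## Solvability fails iff the enstrophy blows up -/

/-- **`(μ, 0, u₀)` is NOT Clay-solvable ⇔ an enstrophy blow-up certificate exists** (`μ > 0`, `u₀`
smooth, divergence free, of class (4)): ⇔ there are `T > 0` and a classical solution `(u, p)` of the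
unforced system on `[0, T) × ℝ³` with `u 0 = u₀`, finite energy on `[0, T)`, and
`∫ |curl u(t)|²` unbounded on `[0, T)`. ((⇒) Leray's alternative `clayR3_solvable_or_supBlowup` and
the `H¹` continuation principle `false_of_enstrophyBound_of_maximal`; (⇐)
`not_clayR3_solvable_of_enstrophyBlowupCertificate`.)
[cite: FeffermanClay2006, (A) (C) with (4)–(7) p. 2] [cite: Leray1934, §33, §20]
[cite: RobinsonRodrigoSadowskiCUP2016, Lemma 6.11 with Thm 6.15] [cite: Tao2011, Thm 5.4, Cor. 11.1, Cor. 11.4] -/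
theorem not_clayR3_solvable_iff_exists_enstrophyBlowup (hμ : 0 < μ) (hu₀ : ContDiff ℝ ∞ u₀)
    (hdiv : NSWave0.IsDivFree u₀) (hdec : HasRapidSpatialDecay u₀) :
    ¬ clayR3.Solvable μ 0 u₀ ↔
      ∃ T : ℝ, 0 < T ∧
        ∃ (u : ℝ → EuclideanSpace ℝ (Fin 3) → EuclideanSpace ℝ (Fin 3))
          (p : ℝ → EuclideanSpace ℝ (Fin 3) → ℝ),
          IsClassicalNSSolutionOn (Ico 0 T) μ 0 u p ∧ u 0 = u₀ ∧
          (∃ A : ℝ≥0∞, A < ⊤ ∧ ∀ t ∈ Ico 0 T, ∫⁻ x, ‖u t x‖ₑ ^ 2 ≤ A) ∧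
          ∀ M : ℝ, ∃ t ∈ Ico 0 T, M < ∫ x, ‖curl (u t) x‖ ^ 2 := by
  constructor
  · intro hno
    rcases clayR3_solvable_or_supBlowup hμ hu₀ hdiv hdec with
      hsol | ⟨T, hT, u, p, hcl, hu0, hE, -, hmax⟩
    · exact absurd hsol hno
    · refine ⟨T, hT, u, p, hcl, hu0, hE, fun M => ?_⟩
      by_contra hbd
      push Not at hbd
      exact false_of_enstrophyBound_of_maximal hμ hT hdec hcl hu0 hE hmax hbd
  · rintro ⟨T, -, u, p, hcl, hu0, hE, hb⟩
    exact not_clayR3_solvable_of_enstrophyBlowupCertificate hμ (hu₀.of_le (by norm_cast)) hdec hcl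
      hu0 hE hb

/-! ## (A) ⇔ the a priori enstrophy bound -/

/-- **(A) at one viscosity ⇔ the a priori ENSTROPHY bound.** For `μ > 0`: `clayR3.RegularityAt μ` ⇔
every classical solution of the unforced system on a half-open slab `[0, T) × ℝ³`, from a smooth
divergence-free datum of class (4), with finite energy on `[0, T)`, has BOUNDED ENSTROPHY
`∫ |curl u(t)|² ≤ M` on `[0, T)`. ((⇒) `exists_enstrophy_le_of_clayR3_solvable`; (⇐)
`clayR3_solvable_or_supBlowup` with `false_of_enstrophyBound_of_maximal`.)
[cite: FeffermanClay2006, (A) with (4) (6) (7) p. 2] [cite: Leray1934, §33, §20]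
[cite: RobinsonRodrigoSadowskiCUP2016, Lemma 6.11 with Thm 6.15] [cite: ConstantinFeffermanIndiana1993, §2 (end of proof)] -/
theorem clayR3_regularityAt_iff_aprioriEnstrophyBound (hμ : 0 < μ) :
    clayR3.RegularityAt μ ↔
      ∀ (u₀ : EuclideanSpace ℝ (Fin 3) → EuclideanSpace ℝ (Fin 3)), ContDiff ℝ ∞ u₀ →
        NSWave0.IsDivFree u₀ → HasRapidSpatialDecay u₀ →
        ∀ (T : ℝ) (u : ℝ → EuclideanSpace ℝ (Fin 3) → EuclideanSpace ℝ (Fin 3))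
          (p : ℝ → EuclideanSpace ℝ (Fin 3) → ℝ),
          IsClassicalNSSolutionOn (Ico 0 T) μ 0 u p → u 0 = u₀ →
          (∃ A : ℝ≥0∞, A < ⊤ ∧ ∀ t ∈ Ico 0 T, ∫⁻ x, ‖u t x‖ₑ ^ 2 ≤ A) →
            ∃ M : ℝ, ∀ t ∈ Ico 0 T, ∫ x, ‖curl (u t) x‖ ^ 2 ≤ M := by
  constructor
  · intro hreg u₀ hu₀ hdiv hdec T u p hcl hu0 hE
    exact exists_enstrophy_le_of_clayR3_solvable hμ (hu₀.of_le (by norm_cast)) hdec hcl hu0 hE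
      (hreg u₀ hu₀ hdiv hdec)
  · intro hbd u₀ hu₀ hdiv hdec
    rcases clayR3_solvable_or_supBlowup hμ hu₀ hdiv hdec with
      hsol | ⟨T, hT, u, p, hcl, hu0, hE, -, hmax⟩
    · exact hsol
    · obtain ⟨M, hM⟩ := hbd u₀ hu₀ hdiv hdec T u p hcl hu0 hE
      exact (false_of_enstrophyBound_of_maximal hμ hT hdec hcl hu0 hE hmax hM).elim

/-- **(A) ⇔ the a priori enstrophy bound at every viscosity** (and, by `clayR3_regularityAt_iff`, at
any single one). `clayR3.Regularity` is token-for-token the summit statement `NavierStokesRegularity`.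
[cite: FeffermanClay2006, (A) with (4) (6) (7) p. 2] [cite: Leray1934, §33, §20]
[cite: RobinsonRodrigoSadowskiCUP2016, Lemma 6.11 with Thm 6.15] -/
theorem clayR3_regularity_iff_aprioriEnstrophyBound :
    clayR3.Regularity ↔
      ∀ μ : ℝ, 0 < μ →
      ∀ (u₀ : EuclideanSpace ℝ (Fin 3) → EuclideanSpace ℝ (Fin 3)), ContDiff ℝ ∞ u₀ →
        NSWave0.IsDivFree u₀ → HasRapidSpatialDecay u₀ →
        ∀ (T : ℝ) (u : ℝ → EuclideanSpace ℝ (Fin 3) → EuclideanSpace ℝ (Fin 3))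
          (p : ℝ → EuclideanSpace ℝ (Fin 3) → ℝ),
          IsClassicalNSSolutionOn (Ico 0 T) μ 0 u p → u 0 = u₀ →
          (∃ A : ℝ≥0∞, A < ⊤ ∧ ∀ t ∈ Ico 0 T, ∫⁻ x, ‖u t x‖ₑ ^ 2 ≤ A) →
            ∃ M : ℝ, ∀ t ∈ Ico 0 T, ∫ x, ‖curl (u t) x‖ ^ 2 ≤ M :=
  ⟨fun h μ hμ => (clayR3_regularityAt_iff_aprioriEnstrophyBound hμ).1 (h μ hμ),
    fun h μ hμ => (clayR3_regularityAt_iff_aprioriEnstrophyBound hμ).2 (h μ hμ)⟩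

/-- **(A) ⇔ the a priori enstrophy bound at ONE viscosity `μ > 0`.**
[cite: FeffermanClay2006, (A) p. 2] [cite: Tao2013Localisation, Rem. 1.2 footnote] -/
theorem clayR3_regularity_iff_aprioriEnstrophyBound_at (hμ : 0 < μ) :
    clayR3.Regularity ↔
      ∀ (u₀ : EuclideanSpace ℝ (Fin 3) → EuclideanSpace ℝ (Fin 3)), ContDiff ℝ ∞ u₀ →
        NSWave0.IsDivFree u₀ → HasRapidSpatialDecay u₀ →
        ∀ (T : ℝ) (u : ℝ → EuclideanSpace ℝ (Fin 3) → EuclideanSpace ℝ (Fin 3))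
          (p : ℝ → EuclideanSpace ℝ (Fin 3) → ℝ),
          IsClassicalNSSolutionOn (Ico 0 T) μ 0 u p → u 0 = u₀ →
          (∃ A : ℝ≥0∞, A < ⊤ ∧ ∀ t ∈ Ico 0 T, ∫⁻ x, ‖u t x‖ₑ ^ 2 ≤ A) →
            ∃ M : ℝ, ∀ t ∈ Ico 0 T, ∫ x, ‖curl (u t) x‖ ^ 2 ≤ M := by
  rw [← clayR3_regularityAt_iff hμ]
  exact clayR3_regularityAt_iff_aprioriEnstrophyBound hμ

/-! ## (A) ⇔ the a priori `‖∇u‖_{L²}` bound -/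

/-- **(A) at one viscosity ⇔ the a priori `‖∇u(t)‖²_{L²}` bound** (`∫ ‖∇u(t)‖ₑ² ≤ C` on `[0, T)`,
operator norm of `fderiv`; `|curl v|² ≤ κ²‖∇v‖²` converts it into an enstrophy bound).
[cite: FeffermanClay2006, (A) with (4) (6) (7) p. 2] [cite: Leray1934, §33, §20]
[cite: RobinsonRodrigoSadowskiCUP2016, Lemma 6.11 with Thm 6.15] -/
theorem clayR3_regularityAt_iff_aprioriGradientL2Bound (hμ : 0 < μ) :
    clayR3.RegularityAt μ ↔
      ∀ (u₀ : EuclideanSpace ℝ (Fin 3) → EuclideanSpace ℝ (Fin 3)), ContDiff ℝ ∞ u₀ →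
        NSWave0.IsDivFree u₀ → HasRapidSpatialDecay u₀ →
        ∀ (T : ℝ) (u : ℝ → EuclideanSpace ℝ (Fin 3) → EuclideanSpace ℝ (Fin 3))
          (p : ℝ → EuclideanSpace ℝ (Fin 3) → ℝ),
          IsClassicalNSSolutionOn (Ico 0 T) μ 0 u p → u 0 = u₀ →
          (∃ A : ℝ≥0∞, A < ⊤ ∧ ∀ t ∈ Ico 0 T, ∫⁻ x, ‖u t x‖ₑ ^ 2 ≤ A) →
            ∃ C : ℝ≥0, ∀ t ∈ Ico 0 T, ∫⁻ x, ‖fderiv ℝ (u t) x‖ₑ ^ 2 ≤ C := by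
  constructor
  · intro hreg u₀ hu₀ hdiv hdec T u p hcl hu0 hE
    exact exists_gradientL2_le_of_clayR3_solvable hμ (hu₀.of_le (by norm_cast)) hdec hcl hu0 hE
      (hreg u₀ hu₀ hdiv hdec)
  · intro hbd
    refine (clayR3_regularityAt_iff_aprioriEnstrophyBound hμ).2
      fun u₀ hu₀ hdiv hdec T u p hcl hu0 hE => ?_
    obtain ⟨C, hC⟩ := hbd u₀ hu₀ hdiv hdec T u p hcl hu0 hE
    refine ⟨‖curlCLM‖ ^ 2 * (C : ℝ), fun t ht => ?_⟩
    have hct2 : ContDiff ℝ 2 (u t) := (hcl.contDiff_velocity ht).of_le (by norm_cast)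
    have h1 : ∫⁻ x, ‖iteratedFDeriv ℝ 1 (u t) x‖ₑ ^ 2 ≤ C := by
      refine le_of_eq_of_le (lintegral_congr fun x => ?_) (hC t ht)
      rw [← ofReal_norm, norm_iteratedFDeriv_one, ofReal_norm]
    exact (integrable_norm_curl_sq hct2 (h1.trans_lt ENNReal.coe_lt_top)).2.trans
      (mul_le_mul_of_nonneg_left (ENNReal.toReal_le_coe_of_le_coe h1) (sq_nonneg _))

/-- **(A) ⇔ the a priori `‖∇u‖_{L²}` bound at every viscosity.**
[cite: FeffermanClay2006, (A) with (4) (6) (7) p. 2] [cite: RobinsonRodrigoSadowskiCUP2016, Lemma 6.11 with Thm 6.15] -/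
theorem clayR3_regularity_iff_aprioriGradientL2Bound :
    clayR3.Regularity ↔
      ∀ μ : ℝ, 0 < μ →
      ∀ (u₀ : EuclideanSpace ℝ (Fin 3) → EuclideanSpace ℝ (Fin 3)), ContDiff ℝ ∞ u₀ →
        NSWave0.IsDivFree u₀ → HasRapidSpatialDecay u₀ →
        ∀ (T : ℝ) (u : ℝ → EuclideanSpace ℝ (Fin 3) → EuclideanSpace ℝ (Fin 3))
          (p : ℝ → EuclideanSpace ℝ (Fin 3) → ℝ),
          IsClassicalNSSolutionOn (Ico 0 T) μ 0 u p → u 0 = u₀ →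
          (∃ A : ℝ≥0∞, A < ⊤ ∧ ∀ t ∈ Ico 0 T, ∫⁻ x, ‖u t x‖ₑ ^ 2 ≤ A) →
            ∃ C : ℝ≥0, ∀ t ∈ Ico 0 T, ∫⁻ x, ‖fderiv ℝ (u t) x‖ₑ ^ 2 ≤ C :=
  ⟨fun h μ hμ => (clayR3_regularityAt_iff_aprioriGradientL2Bound hμ).1 (h μ hμ),
    fun h μ hμ => (clayR3_regularityAt_iff_aprioriGradientL2Bound hμ).2 (h μ hμ)⟩

/-- **(A) ⇔ the a priori `‖∇u‖_{L²}` bound at ONE viscosity `μ > 0`.**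
[cite: FeffermanClay2006, (A) p. 2] [cite: Tao2013Localisation, Rem. 1.2 footnote] -/
theorem clayR3_regularity_iff_aprioriGradientL2Bound_at (hμ : 0 < μ) :
    clayR3.Regularity ↔
      ∀ (u₀ : EuclideanSpace ℝ (Fin 3) → EuclideanSpace ℝ (Fin 3)), ContDiff ℝ ∞ u₀ →
        NSWave0.IsDivFree u₀ → HasRapidSpatialDecay u₀ →
        ∀ (T : ℝ) (u : ℝ → EuclideanSpace ℝ (Fin 3) → EuclideanSpace ℝ (Fin 3))
          (p : ℝ → EuclideanSpace ℝ (Fin 3) → ℝ),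
          IsClassicalNSSolutionOn (Ico 0 T) μ 0 u p → u 0 = u₀ →
          (∃ A : ℝ≥0∞, A < ⊤ ∧ ∀ t ∈ Ico 0 T, ∫⁻ x, ‖u t x‖ₑ ^ 2 ≤ A) →
            ∃ C : ℝ≥0, ∀ t ∈ Ico 0 T, ∫⁻ x, ‖fderiv ℝ (u t) x‖ₑ ^ 2 ≤ C := by
  rw [← clayR3_regularityAt_iff hμ]
  exact clayR3_regularityAt_iff_aprioriGradientL2Bound hμ

/-- **If (A) fails, it fails through an enstrophy blow-up**: `¬ clayR3.Regularity` ⇒ some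
finite-energy classical solution on a half-open slab `[0, T)` from a smooth divergence-free class-(4)
datum, at some viscosity `μ > 0`, has `∫ |curl u(t)|²` unbounded on `[0, T)`.
[cite: FeffermanClay2006, (A) (C) p. 2] [cite: Leray1934, §33, §20] -/
theorem exists_enstrophyBlowup_of_not_clayR3_regularity (h : ¬ clayR3.Regularity) :
    ∃ μ : ℝ, 0 < μ ∧ ∃ u₀ : EuclideanSpace ℝ (Fin 3) → EuclideanSpace ℝ (Fin 3),
      ContDiff ℝ ∞ u₀ ∧ NSWave0.IsDivFree u₀ ∧ HasRapidSpatialDecay u₀ ∧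
      ∃ (T : ℝ) (u : ℝ → EuclideanSpace ℝ (Fin 3) → EuclideanSpace ℝ (Fin 3))
        (p : ℝ → EuclideanSpace ℝ (Fin 3) → ℝ),
        IsClassicalNSSolutionOn (Ico 0 T) μ 0 u p ∧ u 0 = u₀ ∧
        (∃ A : ℝ≥0∞, A < ⊤ ∧ ∀ t ∈ Ico 0 T, ∫⁻ x, ‖u t x‖ₑ ^ 2 ≤ A) ∧
        ∀ M : ℝ, ∃ t ∈ Ico 0 T, M < ∫ x, ‖curl (u t) x‖ ^ 2 := by
  rw [clayR3_regularity_iff_aprioriEnstrophyBound] at h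
  push Not at h
  exact h

end

end Literature.Claims.NS.ClayVariants

-- WHAT THIS IS NOT: not a claim about NS regularity or blow-up; not a claim about any author beyond
-- the typed locator.
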